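import Mathlib.Data.Real.Basic
import Mathlib.Tactic.NormNum
import Mathlib.Tactic.Ring
import Mathlib.Tactic.Linarith
import Mathlib.Tactic.Positivity
import Summits.CriticalPhenomena.PercolationContinuityZ3.Theorems.PercNearOneGluingNoHeavyLowerTailCubicThreePointBernsteinStep
import HarnessLib

/-!
# `NoHeavyLowerTail` (stmt-CriticalPhenomena-4575) — the cubic strong-Harris row G3 = AG⁺: one-coordinate step in
TWELVE-TYPE form, its Bernstein / log-derivative reduction ("Conjecture M"), and the exact fake coupling

Support file (prover prim-ineq-gen-4 gen 4; `--supports stmt-CriticalPhenomena-4575`).  Pure algebra: no measure theory, no named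
facts, no sorries.  Companion of `…CubicThreePointBernsteinStep` (prim-ineq-prove-2: the SHK3⁺ apex-edge step in five cells + five
transitions) — here the ABSTRACT setting of Gladkov's Thm. 2.1 (tree: `Literature.Probability.LatticeModels.StrongHarris.core`):
a product measure on a cube, a partition `A ⊔ C₁ ⊔ C₂ ⊔ C₃ ⊔ B` with every `A ∪ C_i` closed upwards, and the cubic row
      `G3 := μ(A) μ(B) − e₂(μ(C_i)) − e₃(μ(C_i)) ≥ 0`
(`= AG⁺ = qt − e₂(u) − e₃(u)` for the percolation cells; it implies SHK3⁺ since `F = AG⁺ + t·AG`).  Splitting along one coordinate `e`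
of weight `p`, a point of the remaining cube has a TYPE `(class at x_e = 0, class at x_e = 1)`, one of the twelve monotone pairs
`BB, BC_i, BA, C_iC_i, C_iA, AA`; write `b₀, m_i, d, o_i, q_i, a₀` for their masses (so slice 0 has law
`(a₀; o_i+q_i; b₀+d+Σm)`, slice 1 has `(a₀+d+Σq; o_i+m_i; b₀)`, and the whole cube `a = a₀ + p(d+Σq)`, `c_i = o_i+q_i+p(m_i−q_i)`,
`b = b₀+(1−p)(d+Σm)`).

WHAT IS PROVED (all `ring` / `linarith`):
* `bernstein_expansion` — the exact identity
      `G3(law(p)) = F₀(1−p)³ + (F₀+P₁)(1−p)²p + (F₁+P₂)(1−p)p² + F₁p³`,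
  `F₀, F₁` = G3 of the two slices, `P₁ = F₀+F₁+M+S₂+S₃`, `P₂ = F₀+F₁+M+S₂+2S₃` with Gladkov's quadratic step term
  `M = d²+d(Σq+Σm)+Σq_im_i+e₂(q)+e₂(m)` and the cubic corrections `S₂ = Σ_j (o_j+q_j)δ_iδ_k`, `S₃ = δ₁δ₂δ₃`, `δ = m − q`
  (so `3β₁ = 2F₀+F₁+B(0)`, `3β₂ = F₀+2F₁+B(1)`, `B(p) = M+S₂+(1+p)S₃` is the "chord bracket");
* `G3_mixture_nonneg_of_step` — hence `F₀, F₁ ≥ 0` (induction hypotheses) and `P₁, P₂ ≥ 0` give `G3(law(p)) ≥ 0` on `[0,1]`;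
* `P_one_dual` — the up/down duality (`a₀ ↔ b₀`, `q ↔ m`, `p ↔ 1−p`) exchanges `P₁` and `P₂`, so ONE inequality `P₂ ≥ 0` for all
  realizable type data is the whole step ("CONJECTURE M": equivalently `f(p)/p²` is non-increasing and `f/(1−p)²` non-decreasing
  in every single coordinate weight, `logDeriv_form`); `AG_logDeriv` — the analogous statement for Gladkov's quadratic AG is a THEOREM;
* `fakeCoupling_*` — the exact rational type vector `(b₀,m₁,o₁,o₂,q₂,o₃,a₀) = (4/25,1/5,3/25,3/25,1/5,1/25,4/25)` (all other types 0)
  has both slices satisfying G3 (`F₀ = F₁ = 1/15625`) — and, by an exact external check (memo below: ALL 3 732 ≤3-petal monotone-image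
  rows, Gladkov k ≤ 4, and all 291 466 four-functions instances on type-sets of size ≤ 4), satisfies every induction-hypothesis /
  Ahlswede–Daykin constraint available one level down — yet `P₂ = −23/15625` and `G3(law(½)) = −21/62500 < 0`: the step is NOT a
  consequence of those constraint families (its slice law violates `Hqt`, so the vector is not realizable if `Hqt`/`Hmax` hold).
Memo: run/shared/lean/prim/prim-ineq-gen-4/FINDING-ONESTEP-NOGO-AND-CONJ-M-g4.md; numerics: `P₁,P₂ ≥ 0` has 0 violations on ≈2·10⁵
coordinate instances of realizable sunflowers (n ≤ 6) and, in percolation form, on all edges of 1 640 exact weighted graphs (n ≤ 6).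
[cite: Gladkov2024StrongFKG, Thm. 2.1 and its proof (the cells `A₀,B₀,C_i^±,C_i^∘,D` and the quadratic step)]
-/

namespace Summit.CriticalPhenomena.PercolationContinuityZ3.Theorems

namespace StrongHarrisCubicStep

variable {R : Type*} [CommRing R]

/-- The cubic strong-Harris row `G3(a; c₁,c₂,c₃; b) = a b − e₂(c) − e₃(c)` (= AG⁺ on the percolation cells
`(t; u₁,u₂,u₃; q)`), over any commutative ring. [cite: Gladkov2024StrongFKG, Thm. 2.1 (quadratic part `ab − e₂`)] -/
def G3 (a c₁ c₂ c₃ b : R) : R :=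
  a * b - (c₁ * c₂ + c₁ * c₃ + c₂ * c₃) - c₁ * c₂ * c₃

/-- G3 of slice `0` (coordinate `e` closed) in the twelve type masses. [folklore] -/
def F₀ (a₀ b₀ d q₁ q₂ q₃ o₁ o₂ o₃ m₁ m₂ m₃ : R) : R :=
  G3 a₀ (o₁ + q₁) (o₂ + q₂) (o₃ + q₃) (b₀ + d + m₁ + m₂ + m₃)

/-- G3 of slice `1` (coordinate `e` open) in the twelve type masses. [folklore] -/
def F₁ (a₀ b₀ d q₁ q₂ q₃ o₁ o₂ o₃ m₁ m₂ m₃ : R) : R :=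
  G3 (a₀ + d + q₁ + q₂ + q₃) (o₁ + m₁) (o₂ + m₂) (o₃ + m₃) b₀

/-- Gladkov's quadratic step term `M = d² + d(Σq+Σm) + Σ q_i m_i + e₂(q) + e₂(m)` (manifestly `≥ 0` on nonnegative data).
[cite: Gladkov2024StrongFKG, proof of Thm. 2.1 (coefficient of `p²`)] -/
def M (d q₁ q₂ q₃ m₁ m₂ m₃ : R) : R :=
  d ^ 2 + d * (q₁ + q₂ + q₃ + m₁ + m₂ + m₃) + (q₁ * m₁ + q₂ * m₂ + q₃ * m₃) +
    (q₁ * q₂ + q₁ * q₃ + q₂ * q₃) + (m₁ * m₂ + m₁ * m₃ + m₂ * m₃)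

/-- The first cubic correction `S₂ = Σ_j (o_j+q_j) δ_i δ_k`, `δ = m − q`. [folklore] -/
def S₂ (q₁ q₂ q₃ o₁ o₂ o₃ m₁ m₂ m₃ : R) : R :=
  (o₁ + q₁) * ((m₂ - q₂) * (m₃ - q₃)) + (o₂ + q₂) * ((m₁ - q₁) * (m₃ - q₃)) +
    (o₃ + q₃) * ((m₁ - q₁) * (m₂ - q₂))

/-- The second cubic correction `S₃ = δ₁ δ₂ δ₃`, `δ = m − q`. [folklore] -/
def S₃ (q₁ q₂ q₃ m₁ m₂ m₃ : R) : R :=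
  (m₁ - q₁) * (m₂ - q₂) * (m₃ - q₃)

/-- `P₁ = F₀ + F₁ + M + S₂ + S₃` (`= 3β₁ − β₀` for the Bernstein coefficients of `p ↦ G3(law(p))`). [folklore] -/
def P₁ (a₀ b₀ d q₁ q₂ q₃ o₁ o₂ o₃ m₁ m₂ m₃ : R) : R :=
  F₀ a₀ b₀ d q₁ q₂ q₃ o₁ o₂ o₃ m₁ m₂ m₃ + F₁ a₀ b₀ d q₁ q₂ q₃ o₁ o₂ o₃ m₁ m₂ m₃ + M d q₁ q₂ q₃ m₁ m₂ m₃ +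
    S₂ q₁ q₂ q₃ o₁ o₂ o₃ m₁ m₂ m₃ + S₃ q₁ q₂ q₃ m₁ m₂ m₃

/-- `P₂ = F₀ + F₁ + M + S₂ + 2 S₃` (`= 3β₂ − β₃`). [folklore] -/
def P₂ (a₀ b₀ d q₁ q₂ q₃ o₁ o₂ o₃ m₁ m₂ m₃ : R) : R :=
  F₀ a₀ b₀ d q₁ q₂ q₃ o₁ o₂ o₃ m₁ m₂ m₃ + F₁ a₀ b₀ d q₁ q₂ q₃ o₁ o₂ o₃ m₁ m₂ m₃ + M d q₁ q₂ q₃ m₁ m₂ m₃ +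
    S₂ q₁ q₂ q₃ o₁ o₂ o₃ m₁ m₂ m₃ + 2 * S₃ q₁ q₂ q₃ m₁ m₂ m₃

/-- G3 of the whole cube when the split coordinate has weight `p`:
`a = a₀ + p(d+Σq)`, `c_i = o_i + q_i + p(m_i − q_i)`, `b = b₀ + (1−p)(d+Σm)`. [folklore] -/
def mixG3 (a₀ b₀ d q₁ q₂ q₃ o₁ o₂ o₃ m₁ m₂ m₃ p : R) : R :=
  G3 (a₀ + p * (d + q₁ + q₂ + q₃)) (o₁ + q₁ + p * (m₁ - q₁)) (o₂ + q₂ + p * (m₂ - q₂))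
    (o₃ + q₃ + p * (m₃ - q₃)) (b₀ + (1 - p) * (d + m₁ + m₂ + m₃))

/-- **Bernstein expansion of the cubic row along one coordinate.**
`G3(law(p)) = F₀(1−p)³ + (F₀+P₁)(1−p)²p + (F₁+P₂)(1−p)p² + F₁ p³` — a polynomial identity in the thirteen variables (no use of
total mass `1`).  Equivalently `G3(law(p)) = (1−p)F₀ + pF₁ + p(1−p)[M + S₂ + (1+p)S₃]`.
[cite: Gladkov2024StrongFKG, proof of Thm. 2.1 (the quadratic part of this identity)] -/
theorem bernstein_expansion (a₀ b₀ d q₁ q₂ q₃ o₁ o₂ o₃ m₁ m₂ m₃ p : R) :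
    mixG3 a₀ b₀ d q₁ q₂ q₃ o₁ o₂ o₃ m₁ m₂ m₃ p =
      F₀ a₀ b₀ d q₁ q₂ q₃ o₁ o₂ o₃ m₁ m₂ m₃ * (1 - p) ^ 3 +
        (F₀ a₀ b₀ d q₁ q₂ q₃ o₁ o₂ o₃ m₁ m₂ m₃ + P₁ a₀ b₀ d q₁ q₂ q₃ o₁ o₂ o₃ m₁ m₂ m₃) * ((1 - p) ^ 2 * p) +
        (F₁ a₀ b₀ d q₁ q₂ q₃ o₁ o₂ o₃ m₁ m₂ m₃ + P₂ a₀ b₀ d q₁ q₂ q₃ o₁ o₂ o₃ m₁ m₂ m₃) * ((1 - p) * p ^ 2) +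
        F₁ a₀ b₀ d q₁ q₂ q₃ o₁ o₂ o₃ m₁ m₂ m₃ * p ^ 3 := by
  simp only [mixG3, F₀, F₁, P₁, P₂, M, S₂, S₃, G3]
  ring

/-- The "chord-bracket" form of the same identity: `G3(law(p)) = (1−p)F₀ + pF₁ + p(1−p)(M + S₂ + (1+p)S₃)`. [folklore] -/
theorem bracket_expansion (a₀ b₀ d q₁ q₂ q₃ o₁ o₂ o₃ m₁ m₂ m₃ p : R) :
    mixG3 a₀ b₀ d q₁ q₂ q₃ o₁ o₂ o₃ m₁ m₂ m₃ p =
      (1 - p) * F₀ a₀ b₀ d q₁ q₂ q₃ o₁ o₂ o₃ m₁ m₂ m₃ + p * F₁ a₀ b₀ d q₁ q₂ q₃ o₁ o₂ o₃ m₁ m₂ m₃ +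
        p * (1 - p) * (M d q₁ q₂ q₃ m₁ m₂ m₃ + S₂ q₁ q₂ q₃ o₁ o₂ o₃ m₁ m₂ m₃ +
          (1 + p) * S₃ q₁ q₂ q₃ m₁ m₂ m₃) := by
  simp only [mixG3, F₀, F₁, M, S₂, S₃, G3]
  ring

/-- **Up/down duality.**  Reversing the cube order swaps `A ↔ B`, slice `0 ↔ 1`, i.e. `a₀ ↔ b₀`, `q_i ↔ m_i` (`d`, `o_i` fixed) and
`p ↔ 1−p`; it maps `P₁` to `P₂` (and `F₀ ↔ F₁`, `M, S₂+3S₃/… ` accordingly).  Hence `P₂ ≥ 0` for all realizable type data already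
gives `P₁ ≥ 0` for all realizable type data. [folklore] -/
theorem P_one_dual (a₀ b₀ d q₁ q₂ q₃ o₁ o₂ o₃ m₁ m₂ m₃ : R) :
    P₁ b₀ a₀ d m₁ m₂ m₃ o₁ o₂ o₃ q₁ q₂ q₃ = P₂ a₀ b₀ d q₁ q₂ q₃ o₁ o₂ o₃ m₁ m₂ m₃ := by
  simp only [P₁, P₂, F₀, F₁, M, S₂, S₃, G3]
  ring

/-- The duality on the whole segment: `G3` of the dual data at `1 − p` is `G3` of the data at `p`. [folklore] -/
theorem mixG3_dual (a₀ b₀ d q₁ q₂ q₃ o₁ o₂ o₃ m₁ m₂ m₃ p : R) :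
    mixG3 b₀ a₀ d m₁ m₂ m₃ o₁ o₂ o₃ q₁ q₂ q₃ (1 - p) = mixG3 a₀ b₀ d q₁ q₂ q₃ o₁ o₂ o₃ m₁ m₂ m₃ p := by
  simp only [mixG3, G3]
  ring

/-- **Log-derivative form of `P₂`** ("Conjecture M"): with `f(p) = G3(law(p))`, `2 f(1) − f′(1) = P₂`; here `f′(1)` is written out
as the derivative of the cubic `bernstein_expansion` at `p = 1`, namely `3F₁ − (F₁ + P₂) = 2F₁ − P₂`… precisely:
`2·F₁ − [3·F₁ − (F₁ + P₂)] = P₂`.  (So `P₂ ≥ 0 ⟺ f′(1) ≤ 2 f(1) ⟺ f/p²` non-increasing at `p = 1`; by splitting the coordinate into two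
independent coordinates in series this is the statement at every `p`.) [folklore] -/
theorem logDeriv_form (a₀ b₀ d q₁ q₂ q₃ o₁ o₂ o₃ m₁ m₂ m₃ : R) :
    2 * F₁ a₀ b₀ d q₁ q₂ q₃ o₁ o₂ o₃ m₁ m₂ m₃ -
        (3 * F₁ a₀ b₀ d q₁ q₂ q₃ o₁ o₂ o₃ m₁ m₂ m₃ -
          (F₁ a₀ b₀ d q₁ q₂ q₃ o₁ o₂ o₃ m₁ m₂ m₃ + P₂ a₀ b₀ d q₁ q₂ q₃ o₁ o₂ o₃ m₁ m₂ m₃)) =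
      P₂ a₀ b₀ d q₁ q₂ q₃ o₁ o₂ o₃ m₁ m₂ m₃ := by
  ring

/-- **The one-coordinate step of the cubic row, reduced to `P₁, P₂ ≥ 0`.**  If G3 holds for both slices (`F₀, F₁ ≥ 0`: the
induction hypotheses of a Gladkov-style induction on the coordinates) and the two p-free type inequalities `P₁ ≥ 0`, `P₂ ≥ 0` hold,
then G3 holds for the whole cube, for every weight `p ∈ [0,1]` of the split coordinate. [folklore] -/
theorem G3_mixture_nonneg_of_step {a₀ b₀ d q₁ q₂ q₃ o₁ o₂ o₃ m₁ m₂ m₃ p : ℝ}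
    (h₀ : 0 ≤ F₀ a₀ b₀ d q₁ q₂ q₃ o₁ o₂ o₃ m₁ m₂ m₃) (h₁ : 0 ≤ F₁ a₀ b₀ d q₁ q₂ q₃ o₁ o₂ o₃ m₁ m₂ m₃)
    (hP₁ : 0 ≤ P₁ a₀ b₀ d q₁ q₂ q₃ o₁ o₂ o₃ m₁ m₂ m₃) (hP₂ : 0 ≤ P₂ a₀ b₀ d q₁ q₂ q₃ o₁ o₂ o₃ m₁ m₂ m₃)
    (hp₀ : 0 ≤ p) (hp₁ : p ≤ 1) :
    0 ≤ mixG3 a₀ b₀ d q₁ q₂ q₃ o₁ o₂ o₃ m₁ m₂ m₃ p := by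
  rw [bernstein_expansion]
  exact CubicThreePointStep.bernstein_cubic_nonneg h₀ (by linarith) (by linarith) h₁ hp₀ hp₁

/-- **Calibration: for Gladkov's quadratic row the analogue of Conjecture M is a theorem.**  With
`g(p) = (1−p)G₀ + pG₁ + p(1−p)M` (`G₀, G₁, M ≥ 0` — the shape of `AG(law(p))` in Gladkov's proof),
`2g(p) − p g′(p) = (2−p)G₀ + pG₁ + pM ≥ 0` on `[0,1]`, i.e. `AG/p²` (indeed even `AG/p`) is non-increasing in every coordinate
weight. [cite: Gladkov2024StrongFKG, proof of Thm. 2.1] -/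
theorem AG_logDeriv {G₀ G₁ M' p : ℝ} (h₀ : 0 ≤ G₀) (h₁ : 0 ≤ G₁) (hM : 0 ≤ M') (hp₀ : 0 ≤ p) (hp₁ : p ≤ 1) :
    0 ≤ 2 * ((1 - p) * G₀ + p * G₁ + p * (1 - p) * M') - p * (-G₀ + G₁ + (1 - 2 * p) * M') := by
  have e : 2 * ((1 - p) * G₀ + p * G₁ + p * (1 - p) * M') - p * (-G₀ + G₁ + (1 - 2 * p) * M') =
      (2 - p) * G₀ + p * G₁ + p * M' := by ring
  rw [e]
  have : 0 ≤ (2 - p) * G₀ := mul_nonneg (by linarith) h₀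
  have : 0 ≤ p * G₁ := mul_nonneg hp₀ h₁
  have : 0 ≤ p * M' := mul_nonneg hp₀ hM
  linarith

/-! ### The exact fake coupling (types `BB, BC₁, C₁C₁, C₂C₂, C₂A, C₃C₃, AA` = `4/25, 1/5, 3/25, 3/25, 1/5, 1/25, 4/25`) -/

/-- Both slices of the fake coupling satisfy G3 (`F₀ = F₁ = 1/15625 > 0`). [folklore] -/
theorem fakeCoupling_slices :
    F₀ (4/25 : ℚ) (4/25) 0 0 (1/5) 0 (3/25) (3/25) (1/25) (1/5) 0 0 = 1/15625 ∧
      F₁ (4/25 : ℚ) (4/25) 0 0 (1/5) 0 (3/25) (3/25) (1/25) (1/5) 0 0 = 1/15625 := by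
  constructor <;> norm_num [F₀, F₁, G3]

/-- … its Gladkov term and `S₃` vanish and `S₂ = −1/625`, so `P₂ = P₁ = −23/15625 < 0` … [folklore] -/
theorem fakeCoupling_P :
    M (0 : ℚ) 0 (1/5) 0 (1/5) 0 0 = 0 ∧ S₃ (0 : ℚ) (1/5) 0 (1/5) 0 0 = 0 ∧
      S₂ (0 : ℚ) (1/5) 0 (3/25) (3/25) (1/25) (1/5) 0 0 = -1/625 ∧
      P₂ (4/25 : ℚ) (4/25) 0 0 (1/5) 0 (3/25) (3/25) (1/25) (1/5) 0 0 = -23/15625 ∧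
      P₁ (4/25 : ℚ) (4/25) 0 0 (1/5) 0 (3/25) (3/25) (1/25) (1/5) 0 0 = -23/15625 := by
  refine ⟨?_, ?_, ?_, ?_, ?_⟩ <;> norm_num [M, S₃, S₂, P₁, P₂, F₀, F₁, G3]

/-- … and G3 FAILS for the mixture at `p = 1/2`: `G3(law(1/2)) = −21/62500`.  Together with the external exact check recorded in
the module docstring (every ≤3-petal image row, Gladkov `k ≤ 4` and every four-functions instance on type-sets of size `≤ 4` holds at
this vector) this shows the one-coordinate step of G3 is not a consequence of those constraint families. [folklore] -/
theorem fakeCoupling_mid :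
    mixG3 (4/25 : ℚ) (4/25) 0 0 (1/5) 0 (3/25) (3/25) (1/25) (1/5) 0 0 (1/2) = -21/62500 := by
  norm_num [mixG3, G3]

/-- The two four-functions (Ahlswede–Daykin) instances that kill Gladkov–style no-go data of `…CubicThreePointNoGo` /
`…BernsteinStep.apexNoGo_sectionHarris` — `o_j m_i ≤ b₀(a₀+q_j)` and `o_j q_k ≤ a₀(b₀+m_j)` — are satisfied here WITH ROOM
(`o₃m₁ = o₃q₂ = 1/125 < 16/625 = a₀b₀`, `o₂m₁ = o₁q₂ = 3/125 < 36/625`), as is `o₁o₂ ≤ a₀b₀` (`9/625 < 16/625`). [folklore] -/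
theorem fakeCoupling_AD :
    (1/25 : ℚ) * (1/5) < (4/25) * (4/25) ∧ (3/25 : ℚ) * (1/5) < (4/25) * (4/25 + 1/5) ∧
      (3/25 : ℚ) * (3/25) < (4/25) * (4/25) := by
  refine ⟨?_, ?_, ?_⟩ <;> norm_num

end StrongHarrisCubicStep

end Summit.CriticalPhenomena.PercolationContinuityZ3.Theorems
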